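import Summits.CriticalPhenomena.PercolationContinuityZ3.Theorems.PercNearOneGluingNoHeavyLowerTailSahiOneStepLayerMonotone
import Summits.CriticalPhenomena.PercolationContinuityZ3.Theorems.PercNearOneGluingNoHeavyLowerTailSahiOneStepLayerPositive
import Literature.Probability.LatticeModels.ProdBernoulliIndependence
import HarnessLib

/-!
# THEOREM D: the `(2′)` half (hence Kahn C5 / Sahi `C₃` in a threshold slot) for two increasing events with DISJOINT SUPPORTS,
# every density vector

Support file (prover prim-ineq-prove-3 gen 30; `--supports stmt-CriticalPhenomena-4575`; memo
`run/shared/lean/prim/prim-ineq-prove-3/PROOF-G30-SHIFTED-PARTNER.md` §9).  No definitions, no named facts, no sorries, no `native_decide`.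

`F = F₁ ⊔ F₂`, `A` increasing determined by `F₁`, `B` increasing determined by `F₂`, `H = Th_t(F)`, any `p ∈ [0,1]^ι`:
`osN_threshold_nonneg_of_disjointSupports : 0 ≤ N_t(1_A, 1_B)` and `sahiE3_threshold_nonneg_of_disjointSupports : 0 ≤ E₃(1_H, 1_A, 1_B)`.
Since `Cov(A,B) = 0`, `(2′)` says `Cov(A, B ∣ N_F < t) ≤ 0`.  Proof: with `a_j = μ(A ∩ {N_{F₁}=j})`, `u_j = μ{N_{F₁}=j}`, `b_k, v_k` likewise
on `F₂` (independent blocks), `N_t = (Σ_S a_j v_k)(Σ_S u_j b_k) − (Σ_S u_j v_k)(Σ_S a_j b_k)`, `S = {j + k < t}` (`real_threshold_inter_eq`);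
the ratios `a/u`, `b/v` are non-decreasing (LAYER MONOTONICITY `real_inter_layer_mul_le`), and on the staircase `S` this forces
`(Σ_S uv)(Σ_S ab) ≤ (Σ_S av)(Σ_S ub)` (`staircase_sum_le`: initial-segment averages of an MLR-increasing sequence increase, then a two-weight
Chebyshev induction) — the negative dependence of `(N_{F₁}, N_{F₂})` given `N_{F₁} + N_{F₂} < t`.
-/

noncomputable section

namespace Summit.CriticalPhenomena.PercolationContinuityZ3.Theorems

namespace SahiOneStep

open MeasureTheory Finset
open Literature.Probability.Percolation (DeterminedBy determinedBy_iff)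
open Literature.Probability.LatticeModels (prodBernoulli sahiE3 prodBernoulli_real_inter_of_determinedBy_disjoint)
open Literature.Probability.Percolation.DecisionTree (ind)
open scoped Classical

variable {ι : Type*} [Fintype ι]

/-! ## §1 The staircase inequality (pure algebra) -/

/-- Initial segments of an MLR-increasing pair of sequences: for `k ≤ k'` (segment `{j + k' < t}` inside segment `{j + k < t}`),
`A(k')·U(k) ≤ A(k)·U(k')` where `U(k) = Σ_{j+k<t} u_j`, `A(k) = Σ_{j+k<t} a_j`. [folklore] -/
theorem initialSegment_mul_le (M t : ℕ) (u a : ℕ → ℝ) (mlr : ∀ i j, i ≤ j → a i * u j ≤ a j * u i) {k k' : ℕ} (hkk' : k ≤ k') :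
    (∑ j ∈ range M, if j + k' < t then a j else 0) * (∑ j ∈ range M, if j + k < t then u j else 0) ≤
      (∑ j ∈ range M, if j + k < t then a j else 0) * (∑ j ∈ range M, if j + k' < t then u j else 0) := by
  -- split the longer segment: `[j+k<t] = [j+k'<t] + [j+k<t ∧ ¬ j+k'<t]`
  have hsplit : ∀ x : ℕ → ℝ, (∑ j ∈ range M, if j + k < t then x j else 0) =
      (∑ j ∈ range M, if j + k' < t then x j else 0) + ∑ j ∈ range M, if j + k < t ∧ ¬ (j + k' < t) then x j else 0 := by
    intro x
    rw [← Finset.sum_add_distrib]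
    refine Finset.sum_congr rfl fun j _ => ?_
    by_cases h1 : j + k' < t
    · have h2 : j + k < t := by omega
      simp [h1, h2]
    · by_cases h2 : j + k < t
      · simp [h1, h2]
      · simp [h1, h2]
  rw [hsplit u, hsplit a, mul_add, add_mul]
  refine add_le_add le_rfl ?_
  -- `A(k')·R_u ≤ R_a·U(k')`, termwise by MLR since every `j` of the short segment is below every `j'` of the remainder
  rw [Finset.sum_mul_sum, Finset.sum_mul_sum, Finset.sum_comm]
  refine Finset.sum_le_sum fun j' _ => Finset.sum_le_sum fun j _ => ?_
  by_cases h1 : j + k' < t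
  · by_cases h2 : j' + k < t ∧ ¬ (j' + k' < t)
    · rw [if_pos h1, if_pos h2, if_pos h2, if_pos h1]
      exact mlr j j' (by omega)
    · rw [if_neg h2, if_neg h2]; simp
  · rw [if_neg h1, if_neg h1]; simp

/-- **Two-weight Chebyshev step.**  If `A(k')·U(k) ≤ A(k)·U(k')` for `k ≤ k'` and `b/v` is non-decreasing (cross-multiplied), then
`(Σ_k v_k U_k)(Σ_k b_k A_k) ≤ (Σ_k v_k A_k)(Σ_k b_k U_k)`. [folklore] -/
theorem twoWeight_sum_mul_sum_le (N : ℕ) (v b U A : ℕ → ℝ) (hseg : ∀ k k', k ≤ k' → A k' * U k ≤ A k * U k')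
    (mlrB : ∀ i j, i ≤ j → b i * v j ≤ b j * v i) :
    (∑ k ∈ range N, v k * U k) * (∑ k ∈ range N, b k * A k) ≤ (∑ k ∈ range N, v k * A k) * (∑ k ∈ range N, b k * U k) := by
  induction N with
  | zero => simp
  | succ n ih =>
    rw [Finset.sum_range_succ, Finset.sum_range_succ, Finset.sum_range_succ, Finset.sum_range_succ]
    set SA := ∑ k ∈ range n, v k * A k with hSA
    set SB := ∑ k ∈ range n, b k * U k with hSB
    set SU := ∑ k ∈ range n, v k * U k with hSU
    set SBA := ∑ k ∈ range n, b k * A k with hSBA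
    have key : 0 ≤ ∑ k ∈ range n, (A n * U k - A k * U n) * (b k * v n - b n * v k) := by
      refine Finset.sum_nonneg fun k hk => ?_
      have hkn : k ≤ n := (Finset.mem_range.1 hk).le
      exact mul_nonneg_of_nonpos_of_nonpos (sub_nonpos.2 (hseg k n hkn)) (sub_nonpos.2 (mlrB k n hkn))
    have hsum : ∑ k ∈ range n, (A n * U k - A k * U n) * (b k * v n - b n * v k) =
        v n * A n * SB - b n * A n * SU - (v n * U n * SBA - b n * U n * SA) := by
      rw [hSA, hSB, hSU, hSBA, Finset.mul_sum, Finset.mul_sum, Finset.mul_sum, Finset.mul_sum, ← Finset.sum_sub_distrib,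
        ← Finset.sum_sub_distrib, ← Finset.sum_sub_distrib]
      exact Finset.sum_congr rfl fun k _ => by ring
    nlinarith [ih, key, hsum]

/-- **The staircase inequality.**  For sequences with `a/u` and `b/v` non-decreasing (cross-multiplied MLR) and the staircase weights
`U(k) = Σ_{j+k<t} u_j`, `A(k) = Σ_{j+k<t} a_j`:  `(Σ_k v_k U(k))·(Σ_k b_k A(k)) ≤ (Σ_k v_k A(k))·(Σ_k b_k U(k))`. [folklore] -/
theorem staircase_sum_le (M N t : ℕ) (u a v b : ℕ → ℝ) (mlrA : ∀ i j, i ≤ j → a i * u j ≤ a j * u i)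
    (mlrB : ∀ i j, i ≤ j → b i * v j ≤ b j * v i) :
    (∑ k ∈ range N, v k * ∑ j ∈ range M, if j + k < t then u j else 0) * (∑ k ∈ range N, b k * ∑ j ∈ range M, if j + k < t then a j else 0) ≤
      (∑ k ∈ range N, v k * ∑ j ∈ range M, if j + k < t then a j else 0) * (∑ k ∈ range N, b k * ∑ j ∈ range M, if j + k < t then u j else 0) :=
  twoWeight_sum_mul_sum_le N v b (fun k => ∑ j ∈ range M, if j + k < t then u j else 0) (fun k => ∑ j ∈ range M, if j + k < t then a j else 0)
    (fun _ _ hkk' => initialSegment_mul_le M t u a mlrA hkk') mlrB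

/-! ## §2 The block decomposition of the five measures -/

section blocks
variable (p : ι → unitInterval) {F₁ F₂ : Finset ι} (hd : Disjoint F₁ F₂) (t : ℕ)
include hd

omit [Fintype ι] in
/-- On the cell `{N_{F₁} = j} ∩ {N_{F₂} = k}` the threshold event `Th_t(F₁ ∪ F₂)` is all or nothing. [folklore] -/
theorem threshold_inter_cells (E₁ E₂ : Set (Set ι)) (j k : ℕ) :
    {ω : Set ι | t ≤ ((F₁ ∪ F₂).filter (· ∈ ω)).card} ∩ (E₁ ∩ E₂) ∩ {ω : Set ι | (F₂.filter (· ∈ ω)).card = k}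
        ∩ {ω : Set ι | (F₁.filter (· ∈ ω)).card = j} =
      if t ≤ j + k then (E₁ ∩ {ω : Set ι | (F₁.filter (· ∈ ω)).card = j}) ∩ (E₂ ∩ {ω : Set ι | (F₂.filter (· ∈ ω)).card = k})
      else ∅ := by
  ext ω
  have hcard : ((F₁ ∪ F₂).filter (· ∈ ω)).card = (F₁.filter (· ∈ ω)).card + (F₂.filter (· ∈ ω)).card := by
    rw [Finset.filter_union, Finset.card_union_of_disjoint (Finset.disjoint_filter_filter hd)]
  simp only [Set.mem_inter_iff, Set.mem_setOf_eq, hcard]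
  split_ifs with h
  · simp only [Set.mem_inter_iff, Set.mem_setOf_eq]
    constructor
    · rintro ⟨⟨⟨_, h1, h2⟩, hk⟩, hj⟩; exact ⟨⟨h1, hj⟩, h2, hk⟩
    · rintro ⟨⟨h1, hj⟩, h2, hk⟩; exact ⟨⟨⟨by rw [hj, hk]; exact h, h1, h2⟩, hk⟩, hj⟩
  · simp only [Set.mem_empty_iff_false, iff_false, not_and]
    intro h1 hj
    have := h1.1.1
    rw [hj, h1.2] at this
    exact absurd this h

/-- **Block decomposition.**  For `E₁` determined by `F₁` and `E₂` determined by `F₂` (disjoint blocks):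
`μ(Th_t(F₁∪F₂) ∩ (E₁ ∩ E₂)) = (Σ_j μ(E₁ ∩ {N₁=j}))·(Σ_k μ(E₂ ∩ {N₂=k})) − Σ_k μ(E₂ ∩ {N₂=k})·Σ_{j+k<t} μ(E₁ ∩ {N₁=j})`. [this work] -/
theorem real_threshold_inter_eq {E₁ E₂ : Set (Set ι)} (hE₁ : DeterminedBy E₁ (↑F₁ : Set ι)) (hE₂ : DeterminedBy E₂ (↑F₂ : Set ι)) :
    (prodBernoulli p).real ({ω : Set ι | t ≤ ((F₁ ∪ F₂).filter (· ∈ ω)).card} ∩ (E₁ ∩ E₂)) =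
      (∑ j ∈ range (F₁.card + 1), (prodBernoulli p).real (E₁ ∩ {ω : Set ι | (F₁.filter (· ∈ ω)).card = j})) *
          (∑ k ∈ range (F₂.card + 1), (prodBernoulli p).real (E₂ ∩ {ω : Set ι | (F₂.filter (· ∈ ω)).card = k})) -
        ∑ k ∈ range (F₂.card + 1), (prodBernoulli p).real (E₂ ∩ {ω : Set ι | (F₂.filter (· ∈ ω)).card = k}) *
          ∑ j ∈ range (F₁.card + 1),
            (if j + k < t then (prodBernoulli p).real (E₁ ∩ {ω : Set ι | (F₁.filter (· ∈ ω)).card = j}) else 0) := by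
  rw [real_eq_sum_layers p F₂]
  have hcell : ∀ k ∈ range (F₂.card + 1), (prodBernoulli p).real ({ω : Set ι | t ≤ ((F₁ ∪ F₂).filter (· ∈ ω)).card} ∩ (E₁ ∩ E₂) ∩
      {ω : Set ι | (F₂.filter (· ∈ ω)).card = k}) =
      ∑ j ∈ range (F₁.card + 1), (if t ≤ j + k then
        (prodBernoulli p).real (E₁ ∩ {ω : Set ι | (F₁.filter (· ∈ ω)).card = j}) *
          (prodBernoulli p).real (E₂ ∩ {ω : Set ι | (F₂.filter (· ∈ ω)).card = k}) else 0) := by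
    intro k _
    rw [real_eq_sum_layers p F₁]
    refine Finset.sum_congr rfl fun j _ => ?_
    rw [threshold_inter_cells hd t E₁ E₂ j k]
    split_ifs with h
    · exact prodBernoulli_real_inter_of_determinedBy_disjoint p hd (hE₁.inter (determinedBy_layer F₁ j))
        (hE₂.inter (determinedBy_layer F₂ k)) MeasurableSet.of_discrete MeasurableSet.of_discrete
    · exact measureReal_empty
  rw [Finset.sum_congr rfl hcell]
  have hadd : (∑ k ∈ range (F₂.card + 1), ∑ j ∈ range (F₁.card + 1), (if t ≤ j + k then
        (prodBernoulli p).real (E₁ ∩ {ω : Set ι | (F₁.filter (· ∈ ω)).card = j}) *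
          (prodBernoulli p).real (E₂ ∩ {ω : Set ι | (F₂.filter (· ∈ ω)).card = k}) else 0)) +
      ∑ k ∈ range (F₂.card + 1), (prodBernoulli p).real (E₂ ∩ {ω : Set ι | (F₂.filter (· ∈ ω)).card = k}) *
          ∑ j ∈ range (F₁.card + 1),
            (if j + k < t then (prodBernoulli p).real (E₁ ∩ {ω : Set ι | (F₁.filter (· ∈ ω)).card = j}) else 0) =
      (∑ j ∈ range (F₁.card + 1), (prodBernoulli p).real (E₁ ∩ {ω : Set ι | (F₁.filter (· ∈ ω)).card = j})) *
          (∑ k ∈ range (F₂.card + 1), (prodBernoulli p).real (E₂ ∩ {ω : Set ι | (F₂.filter (· ∈ ω)).card = k})) := by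
    rw [Finset.mul_sum, ← Finset.sum_add_distrib]
    refine Finset.sum_congr rfl fun k _ => ?_
    rw [Finset.mul_sum, ← Finset.sum_add_distrib, Finset.sum_mul]
    refine Finset.sum_congr rfl fun j _ => ?_
    by_cases h : t ≤ j + k
    · rw [if_pos h, if_neg (by omega)]; ring
    · rw [if_neg h, if_pos (by omega)]; ring
  linarith [hadd]

end blocks

/-! ## §3 THEOREM D -/

/-- **THEOREM D (`(2′)` half for disjoint supports).**  `F₁, F₂` disjoint, `A` increasing determined by `F₁`, `B` increasing determined by
`F₂`, any `p ∈ [0,1]^ι`, any `t`:  `0 ≤ N_t(1_A, 1_B)` for the threshold event of `F₁ ∪ F₂`, i.e. `Cov(A, B ∣ N_{F₁∪F₂} < t) ≤ 0`. [this work] -/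
theorem osN_threshold_nonneg_of_disjointSupports (p : ι → unitInterval) {F₁ F₂ : Finset ι} (hd : Disjoint F₁ F₂) (t : ℕ)
    {A B : Set (Set ι)} (hA : IsUpperSet A) (hB : IsUpperSet B) (hAF : DeterminedBy A (↑F₁ : Set ι)) (hBF : DeterminedBy B (↑F₂ : Set ι)) :
    0 ≤ osN p {ω : Set ι | t ≤ ((F₁ ∪ F₂).filter (· ∈ ω)).card} (ind A) (ind B) := by
  have huniv₁ : DeterminedBy (Set.univ : Set (Set ι)) (↑F₁ : Set ι) := by rw [determinedBy_iff]; intro _ _ _; simp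
  have huniv₂ : DeterminedBy (Set.univ : Set (Set ι)) (↑F₂ : Set ι) := by rw [determinedBy_iff]; intro _ _ _; simp
  -- the four block decompositions
  have hAB := real_threshold_inter_eq p hd t hAF hBF
  have hA1 := real_threshold_inter_eq p hd t hAF huniv₂
  have h1B := real_threshold_inter_eq p hd t huniv₁ hBF
  have h11 := real_threshold_inter_eq p hd t huniv₁ huniv₂
  simp only [Set.inter_univ, Set.univ_inter] at hA1 h1B h11
  -- totals of the layer masses
  have hSa : ∑ j ∈ range (F₁.card + 1), (prodBernoulli p).real (A ∩ {ω : Set ι | (F₁.filter (· ∈ ω)).card = j}) =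
      (prodBernoulli p).real A := (real_eq_sum_layers p F₁ A).symm
  have hSb : ∑ k ∈ range (F₂.card + 1), (prodBernoulli p).real (B ∩ {ω : Set ι | (F₂.filter (· ∈ ω)).card = k}) =
      (prodBernoulli p).real B := (real_eq_sum_layers p F₂ B).symm
  have hSu : ∑ j ∈ range (F₁.card + 1), (prodBernoulli p).real {ω : Set ι | (F₁.filter (· ∈ ω)).card = j} = 1 := by
    have h := (real_eq_sum_layers p F₁ Set.univ).symm
    simp only [Set.univ_inter] at h
    rw [h]; exact probReal_univ
  have hSv : ∑ k ∈ range (F₂.card + 1), (prodBernoulli p).real {ω : Set ι | (F₂.filter (· ∈ ω)).card = k} = 1 := by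
    have h := (real_eq_sum_layers p F₂ Set.univ).symm
    simp only [Set.univ_inter] at h
    rw [h]; exact probReal_univ
  -- the staircase inequality fed with the MLR of the layers (layer monotonicity)
  have key := staircase_sum_le (F₁.card + 1) (F₂.card + 1) t
    (fun j => (prodBernoulli p).real {ω : Set ι | (F₁.filter (· ∈ ω)).card = j})
    (fun j => (prodBernoulli p).real (A ∩ {ω : Set ι | (F₁.filter (· ∈ ω)).card = j}))
    (fun k => (prodBernoulli p).real {ω : Set ι | (F₂.filter (· ∈ ω)).card = k})
    (fun k => (prodBernoulli p).real (B ∩ {ω : Set ι | (F₂.filter (· ∈ ω)).card = k}))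
    (fun i j hij => real_inter_layer_mul_le p F₁ hA hAF hij) (fun i j hij => real_inter_layer_mul_le p F₂ hB hBF hij)
  beta_reduce at key
  rw [osN_ind_ind]
  rw [show {ω : Set ι | t ≤ ((F₁ ∪ F₂).filter (· ∈ ω)).card} ∩ A ∩ B =
      {ω : Set ι | t ≤ ((F₁ ∪ F₂).filter (· ∈ ω)).card} ∩ (A ∩ B) from Set.inter_assoc _ _ _, hAB, hA1, h1B, h11, hSa, hSb, hSu, hSv]
  linarith [key]

/-- **KAHN C5 / SAHI `C₃` FOR A THRESHOLD SLOT AND TWO INCREASING EVENTS WITH DISJOINT SUPPORTS**, every density vector: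
`0 ≤ E₃(1_{Th_t(F₁ ⊔ F₂)}, 1_A, 1_B)` for `A` determined by `F₁`, `B` by `F₂`. [this work] -/
theorem sahiE3_threshold_nonneg_of_disjointSupports (p : ι → unitInterval) {F₁ F₂ : Finset ι} (hd : Disjoint F₁ F₂) (t : ℕ)
    {A B : Set (Set ι)} (hA : IsUpperSet A) (hB : IsUpperSet B) (hAF : DeterminedBy A (↑F₁ : Set ι)) (hBF : DeterminedBy B (↑F₂ : Set ι)) :
    0 ≤ sahiE3 (prodBernoulli p) {ω : Set ι | t ≤ ((F₁ ∪ F₂).filter (· ∈ ω)).card} A B := by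
  rw [← osT_ind_ind, osT_eq_osMp_add_osN]
  exact add_nonneg (osMp_threshold_nonneg_all p (F₁ ∪ F₂) t hA hB)
    (osN_threshold_nonneg_of_disjointSupports p hd t hA hB hAF hBF)

/-- **THEOREM D, free-coordinate form.**  `A` increasing determined by `F₁ ⊆ F`, `B` increasing determined by `F ∖ F₁` (so the supports of
`A` and `B` inside the threshold block are disjoint, and both blocks may contain coordinates the events do not depend on): `0 ≤ N_t(1_A, 1_B)`
for the threshold event of `F`, every `p`.  (THEOREM D with the blocks `F₁` and `F ∖ F₁`.) [this work] -/
theorem osN_threshold_nonneg_of_disjointSupports' (p : ι → unitInterval) {F₁ F : Finset ι} (hF : F₁ ⊆ F) (t : ℕ)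
    {A B : Set (Set ι)} (hA : IsUpperSet A) (hB : IsUpperSet B) (hAF : DeterminedBy A (↑F₁ : Set ι))
    (hBF : DeterminedBy B (↑(F \ F₁) : Set ι)) :
    0 ≤ osN p {ω : Set ι | t ≤ (F.filter (· ∈ ω)).card} (ind A) (ind B) := by
  have hFeq : F₁ ∪ (F \ F₁) = F := Finset.union_sdiff_of_subset hF
  have h := osN_threshold_nonneg_of_disjointSupports p (Finset.disjoint_sdiff) t hA hB hAF hBF
  rw [hFeq] at h
  exact h

/-- `E₃` form of the free-coordinate version. [this work] -/
theorem sahiE3_threshold_nonneg_of_disjointSupports' (p : ι → unitInterval) {F₁ F : Finset ι} (hF : F₁ ⊆ F) (t : ℕ)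
    {A B : Set (Set ι)} (hA : IsUpperSet A) (hB : IsUpperSet B) (hAF : DeterminedBy A (↑F₁ : Set ι))
    (hBF : DeterminedBy B (↑(F \ F₁) : Set ι)) :
    0 ≤ sahiE3 (prodBernoulli p) {ω : Set ι | t ≤ (F.filter (· ∈ ω)).card} A B := by
  rw [← osT_ind_ind, osT_eq_osMp_add_osN]
  exact add_nonneg (osMp_threshold_nonneg_all p F t hA hB) (osN_threshold_nonneg_of_disjointSupports' p hF t hA hB hAF hBF)

end SahiOneStep

end Summit.CriticalPhenomena.PercolationContinuityZ3.Theorems
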